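import Summits.BirchSwinnertonDyer.BirchSwinnertonDyer.Theorems.Rank1ResidualJetDerivativeReduction
import Literature.NumberTheory.EllipticCurves.RingClassFieldAbelian
import HarnessLib

/-!
# Crux `JetchevIrreducibleReadingByName` (item 20165, shared K8-t′ / K9), stub S5 `stub_prop44Irred` — Howard 2004
# Lemma 2.7.3 for the WHOLE derived point: under a map on which `σ_ℓ` acts trivially the Kolyvagin derivative
# `D_n = ∏ D_q` loses its factor `D_ℓ` to the scalar `ℓ(ℓ+1)/2`, hence `red P_n ∈ p^k · (…)` — the reduction
# half of the (A)-part of S5 (`ord d_M(mℓ)_λ = ord c_M(mℓ)_λ`) and of bsd-jet's gap `htr` — seat `bsd-potss-k8t-c4`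
# g10; `--supports 20165`, helper; route-free; pure algebra; nothing booked, no item closed, BSD is not proved

WHY. The (A)-half of the registered stub S5 (this seat's `JetchevIrreducibleProp44.zsmul_kolyvaginClass_mem_torsionLocalKer_of_mem_selmerLocalKer_of_red`,
p527490) needs, for the derived Heegner point `P = P_{mℓ}` and the reduction `red` modulo a prime `𝔓 ∣ λ`, `λ = (ℓ)`,
the divisibility `red P ∈ p^M · Ẽ` by a Frobenius-fixed point (road map m1 of the memo
`pub/bsd-potss/k8t-c4/FINDING-20165-localfacts-port-k8t-c4-g10.md` §5). Howard's one-line computation (*"Since `σ_ℓ`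
acts trivially … `(D_ℓ c)(Frob_λ) = Σ_{i=1}^{ℓ} i c(Frob_λ) = ℓ(ℓ+1)/2 · c(Frob_λ)`"*, Lemma 2.7.3) was put in the
kernel by bsd-jet for ONE derivative `D_ℓ` (`JET.map_derivOp_of_map_apply_eq`, p512689). The derived point is
`P_n = Σ_{s ∈ S} s · D_{ℓ₁} ⋯ D_{ℓ_r} y` (tree `KolyvaginOperator.derivedPoint`, the composition along the increasing
list of prime factors), so `D_ℓ` sits anywhere in the product and behind the coset representatives `s`; since
`𝒢_n = Gal(K[n]/K)` is commutative (tree `commute_of_mem_ringClassGal`, Gross §3) it commutes to the front. This file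
proves that bookkeeping, abstractly (any monoid action, commuting hypotheses displayed) and for the tree's concrete
Kolyvagin–Heegner data.

WHAT IS PROVED (pure algebra; no arithmetic input):
* §1 `map_derivOpProd_of_map_apply_eq` — for a list `L ∋ ℓ` with `σ_q σ_ℓ = σ_ℓ σ_q` (`q ∈ L`) and an additive `red`
  with `red ∘ σ_ℓ = red`: `red (D_L y) = (ℓ(ℓ+1)/2) • red (D_{L∖ℓ} y)` (`D_L` = `KolyvaginOperator.derivOpProd`;
  induction on the list, the induction hypothesis applied to the maps `red ∘ σ_q^i`).
* §1 `map_derivedPoint_of_map_apply_eq` — `red (P_n) = (ℓ(ℓ+1)/2) • Σ_{s∈S} red (s · D_{n∖ℓ} y)` for `ℓ ∣ n` prime,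
  when moreover every `s ∈ S` commutes with `σ_ℓ`; and `exists_map_derivedPoint_eq_pow_smul`: for `p` odd with
  `p^k ∣ ℓ + 1` (Zhang's `k ≤ M(ℓ)`), `red (P_n) = p^k • (c • Σ_{s∈S} red (s · D_{n∖ℓ} y))` for some `c : ℕ`.
* §2 `map_derivedPoint_kolyvaginHeegnerData` / `exists_map_derivedPoint_kolyvaginHeegnerData_eq_pow_smul` — the same
  for the CONCRETE `d : KolyvaginHeegnerData Dt β ι n` (`d.derivedPoint`), the commutations supplied by the tree
  (`d.σ q ∈ G_q ≤ 𝒢_n`, `d.S ⊆ 𝒢_n`, `𝒢_n` commutative for `K` imaginary quadratic): for ANY additive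
  `red : E(K[n]) → B` with `red ∘ σ_ℓ = red` — e.g. the reduction modulo a prime above `λ` composed with
  `E(K[n]) ⊆ E(K̄)`, `σ_ℓ` being inertial there.
HONEST FRAMING: algebraic identities; the arithmetic inputs of S5's (A)-half (a Frobenius fixing `K[mℓ]`, the
reduction datum, `σ_ℓ` inertial at `𝔓`) are NOT supplied here; nothing asserted about any curve.

References: [cite: Howard2004HeegnerKolyvagin, Lemma 2.7.3 (arXiv:1202.6340 p. 13)] [cite: GrossLMS1991, §3 (3.5)
(D_ℓ, D_n), §4 (4.1) (P_n)] [cite: McCallumLMS1991, §4 Prop. 4.4 (1)] [cite: Jetchev2008, Prop. 4.6, Prop. 4.7].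
-/

set_option autoImplicit false
-- the Theorems directory repeats the summit name (sibling precedent `KatoDescentPotSupersingularAssembly.lean`)
set_option linter.dupNamespace false

noncomputable section

open scoped Classical

open Finset WeierstrassCurve NumberField Literature.NumberTheory.EllipticCurves
  Literature.NumberTheory.EllipticCurves.ModularForms Summit.BirchSwinnertonDyer.Rank1Residual

namespace Summit.BirchSwinnertonDyer.BirchSwinnertonDyer.Theorems.JetchevIrreducibleProp44

/-! ### §1 The abstract identities -/

section Algebra

variable {G : Type*} [Monoid G] {A : Type*} [AddCommMonoid A] {B : Type*} [AddCommMonoid B]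
  (ρ : G →* AddMonoid.End A)

/-- If `σ` and `τ` commute then so do `σ^i` and `τ`. [folklore] -/
theorem pow_mul_eq_mul_pow_of_mul_eq {σ τ : G} (h : σ * τ = τ * σ) (i : ℕ) :
    σ ^ i * τ = τ * σ ^ i :=
  ((show Commute σ τ from h).pow_left i).eq

/-- A map killing `σ_ℓ` still kills `σ_ℓ` after precomposition with a power of a commuting `σ_q`:
`(red ∘ σ_q^i) (σ_ℓ a) = (red ∘ σ_q^i) a`. [folklore] -/
theorem map_comp_pow_apply_eq {σq σl : G} (h : σq * σl = σl * σq) (red : A →+ B)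
    (hσ : ∀ a, red (ρ σl a) = red a) (i : ℕ) (a : A) :
    (red.comp (ρ (σq ^ i))) (ρ σl a) = (red.comp (ρ (σq ^ i))) a := by
  change red (ρ (σq ^ i) (ρ σl a)) = red (ρ (σq ^ i) a)
  have hmul : ρ (σq ^ i) (ρ σl a) = ρ σl (ρ (σq ^ i) a) := by
    change (ρ (σq ^ i) * ρ σl) a = (ρ σl * ρ (σq ^ i)) a
    rw [← map_mul, ← map_mul, pow_mul_eq_mul_pow_of_mul_eq h i]
  rw [hmul, hσ]

/-- **Howard's Lemma 2.7.3 for the product `D_L = D_{ℓ₁} ∘ ⋯ ∘ D_{ℓ_r}`**: if `ℓ ∈ L`, the `σ_q` (`q ∈ L`) commute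
with `σ_ℓ`, and `red ∘ σ_ℓ = red`, then `red (D_L y) = (ℓ(ℓ+1)/2) • red (D_{L.erase ℓ} y)`. Induction on `L`: at the
head `q = ℓ` this is bsd-jet's `JET.map_derivOp_of_map_apply_eq`; at a head `q ≠ ℓ`,
`red (D_q w) = Σ_i i • (red ∘ σ_q^i) w` and the induction hypothesis applies to each `red ∘ σ_q^i`.
[cite: Howard2004HeegnerKolyvagin, Lemma 2.7.3] [cite: GrossLMS1991, §3 (3.5)] -/
theorem map_derivOpProd_of_map_apply_eq {σ : ℕ → G} {ℓ : ℕ} :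
    ∀ (L : List ℕ), ℓ ∈ L → (∀ q ∈ L, σ q * σ ℓ = σ ℓ * σ q) →
      ∀ (red : A →+ B), (∀ a, red (ρ (σ ℓ) a) = red a) → ∀ (y : A),
        red (KolyvaginOperator.derivOpProd ρ σ L y) =
          (ℓ * (ℓ + 1) / 2) • red (KolyvaginOperator.derivOpProd ρ σ (L.erase ℓ) y)
  | [], hℓ, _, _, _, _ => absurd hℓ (List.not_mem_nil)
  | q :: L, hℓ, hcomm, red, hσ, y => by
    by_cases hq : q = ℓ
    · subst hq
      rw [List.erase_cons_head, KolyvaginOperator.derivOpProd_cons]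
      exact JET.map_derivOp_of_map_apply_eq ρ red hσ q _
    · have hℓL : ℓ ∈ L := by
        rcases List.mem_cons.mp hℓ with h | h
        · exact absurd h.symm hq
        · exact h
      have hcommL : ∀ q' ∈ L, σ q' * σ ℓ = σ ℓ * σ q' := fun q' hq' ↦ hcomm q' (List.mem_cons_of_mem q hq')
      have hqℓ : σ q * σ ℓ = σ ℓ * σ q := hcomm q List.mem_cons_self
      have herase : (q :: L).erase ℓ = q :: L.erase ℓ := List.erase_cons_tail (by simpa using hq)
      rw [herase, KolyvaginOperator.derivOpProd_cons, KolyvaginOperator.derivOpProd_cons]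
      unfold KolyvaginOperator.derivOp
      rw [map_sum, map_sum, Finset.smul_sum]
      refine Finset.sum_congr rfl fun i _ ↦ ?_
      rw [map_nsmul, map_nsmul, smul_comm]
      congr 1
      -- the induction hypothesis for the map `red ∘ σ_q^i`
      exact map_derivOpProd_of_map_apply_eq L hℓL hcommL (red.comp (ρ (σ q ^ i)))
        (map_comp_pow_apply_eq ρ hqℓ red hσ i) y

/-- **Howard's Lemma 2.7.3 for the derived point `P_n = Σ_{s∈S} s (D_n y)`** (`ℓ ∣ n` prime, the `σ_q` and the
`s ∈ S` commuting with `σ_ℓ`, `red ∘ σ_ℓ = red`):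
`red P_n = (ℓ(ℓ+1)/2) • Σ_{s∈S} red (s (D_{n∖ℓ} y))`, with `D_{n∖ℓ}` the product along the list of prime factors of
`n` with `ℓ` erased. [cite: Howard2004HeegnerKolyvagin, Lemma 2.7.3] [cite: GrossLMS1991, §4 (4.1)] -/
theorem map_derivedPoint_of_map_apply_eq {σ : ℕ → G} {n ℓ : ℕ} (hℓ : ℓ ∈ n.primeFactors) (S : Finset G)
    (hcomm : ∀ q ∈ n.primeFactors, σ q * σ ℓ = σ ℓ * σ q) (hcommS : ∀ s ∈ S, s * σ ℓ = σ ℓ * s)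
    (red : A →+ B) (hσ : ∀ a, red (ρ (σ ℓ) a) = red a) (y : A) :
    red (KolyvaginOperator.derivedPoint ρ σ n S y) =
      (ℓ * (ℓ + 1) / 2) • ∑ s ∈ S, red (ρ s (KolyvaginOperator.derivOpProd ρ σ (n.primeFactorsList.erase ℓ) y)) := by
  unfold KolyvaginOperator.derivedPoint
  rw [map_sum, Finset.smul_sum]
  refine Finset.sum_congr rfl fun s hs ↦ ?_
  have hℓL : ℓ ∈ n.primeFactorsList := Nat.mem_primeFactors_iff_mem_primeFactorsList.mp hℓ
  have hcommL : ∀ q ∈ n.primeFactorsList, σ q * σ ℓ = σ ℓ * σ q :=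
    fun q hq ↦ hcomm q (Nat.mem_primeFactors_iff_mem_primeFactorsList.mpr hq)
  -- `red ∘ s` kills `σ_ℓ` as well
  have hσs : ∀ a, (red.comp (ρ s)) (ρ (σ ℓ) a) = (red.comp (ρ s)) a := by
    simpa only [pow_one] using map_comp_pow_apply_eq ρ (hcommS s hs) red hσ 1
  exact map_derivOpProd_of_map_apply_eq ρ n.primeFactorsList hℓL hcommL (red.comp (ρ s)) hσs y

/-- **`red P_n` is `p^k`-divisible** for `p` odd with `p^k ∣ ℓ + 1` (`k ≤ M(ℓ)`), with an explicit witness in the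
span of the `red (s (D_{n∖ℓ} y))`: `red P_n = p^k • (c • Σ_{s∈S} red (s (D_{n∖ℓ} y)))`. [cite: Howard2004HeegnerKolyvagin, Lemma 2.7.3]
[cite: Jetchev2008, Prop. 4.6, Prop. 4.7] -/
theorem exists_map_derivedPoint_eq_pow_smul {σ : ℕ → G} {n ℓ : ℕ} (hℓ : ℓ ∈ n.primeFactors) (S : Finset G)
    (hcomm : ∀ q ∈ n.primeFactors, σ q * σ ℓ = σ ℓ * σ q) (hcommS : ∀ s ∈ S, s * σ ℓ = σ ℓ * s)
    (red : A →+ B) (hσ : ∀ a, red (ρ (σ ℓ) a) = red a) {p k : ℕ} (hp : p.Prime) (hp2 : p ≠ 2)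
    (hk : p ^ k ∣ ℓ + 1) (y : A) :
    ∃ c : ℕ, red (KolyvaginOperator.derivedPoint ρ σ n S y) =
      (p ^ k) • (c • ∑ s ∈ S, red (ρ s (KolyvaginOperator.derivOpProd ρ σ (n.primeFactorsList.erase ℓ) y))) := by
  obtain ⟨c, hc⟩ := JET.pow_dvd_choose_two hp hp2 hk
  exact ⟨c, by rw [map_derivedPoint_of_map_apply_eq ρ hℓ S hcomm hcommS red hσ y, hc, mul_nsmul']⟩

end Algebra

/-! ### §2 The concrete Kolyvagin–Heegner data -/

section Concrete

variable {N : ℕ} [NeZero N] {W : WeierstrassCurve ℚ} {K : Type} [Field K] [NumberField K]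
  {Dt : ModularParametrizationData W N} {β : ℤ} {ι : K →+* ℂ} {n : ℕ}

/-- **Howard's Lemma 2.7.3 for the tree's concrete derived Heegner point `P(n)`** (`KolyvaginHeegnerData.derivedPoint`):
for `K` imaginary quadratic, `n ≠ 0`, a prime `ℓ ∣ n` and ANY additive `red : E(K[n]) → B` killing `σ_ℓ`
(`red (σ_ℓ z) = red z` — e.g. a reduction modulo a prime of `K[n]` at which `σ_ℓ` is inertial, composed with
`E(K[n]) ⊆ E(K̄)`): `red P(n) = (ℓ(ℓ+1)/2) • Σ_{s ∈ S} red (s (D_{n∖ℓ} y(n)))`. The commutations are the tree's: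
`σ_q ∈ G_q ≤ 𝒢_n` (`zpowers_σ`, `ringClassGalOver_le_ringClassGal`), `S ⊆ 𝒢_n` (`S_subset`), `𝒢_n` commutative
(`commute_of_mem_ringClassGal`). [cite: Howard2004HeegnerKolyvagin, Lemma 2.7.3] [cite: GrossLMS1991, §3, §4 (4.1)] -/
theorem map_derivedPoint_kolyvaginHeegnerData (hK : IsImaginaryQuadratic K) (hn : n ≠ 0)
    (d : KolyvaginHeegnerData Dt β ι n) {ℓ : ℕ} (hℓ : ℓ ∈ n.primeFactors)
    {B : Type*} [AddCommMonoid B] (red : (W.baseChange (ringClassField K ι n)).toAffine.Point →+ B)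
    (hσ : ∀ z, red (pointGalHom W (ringClassField K ι n) (d.σ ℓ) z) = red z) :
    red d.derivedPoint = (ℓ * (ℓ + 1) / 2) • ∑ s ∈ d.S,
      red (pointGalHom W (ringClassField K ι n) s
        (KolyvaginOperator.derivOpProd (pointGalHom W (ringClassField K ι n)) d.σ (n.primeFactorsList.erase ℓ) d.y)) := by
  -- every `σ_q`, `q ∣ n`, lies in `𝒢_n`
  have hσmem : ∀ q ∈ n.primeFactors, d.σ q ∈ ringClassGal ι n := fun q hq ↦
    ringClassGalOver_le_ringClassGal ι n (n / q) ((d.zpowers_σ q hq) ▸ Subgroup.mem_zpowers (d.σ q))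
  have hσℓ := hσmem ℓ hℓ
  exact map_derivedPoint_of_map_apply_eq (pointGalHom W (ringClassField K ι n)) hℓ d.S
    (fun q hq ↦ commute_of_mem_ringClassGal hK hn (hσmem q hq) hσℓ)
    (fun s hs ↦ commute_of_mem_ringClassGal hK hn (d.S_subset s hs) hσℓ) red hσ d.y

/-- **`red P(n) ∈ p^k · B` for the concrete data**, `p` odd, `p^k ∣ ℓ + 1` (`k ≤ M(ℓ)`, `Zhang2014.le_kolyvaginIndex_iff`),
with a witness in the `ℕ`-span of the `red (s (D_{n∖ℓ} y(n)))` — the reduction half of S5's (A)-part at `P_{mℓ}` and of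
bsd-jet's `htr`. [cite: Howard2004HeegnerKolyvagin, Lemma 2.7.3] [cite: Jetchev2008, Prop. 4.6, Prop. 4.7] -/
theorem exists_map_derivedPoint_kolyvaginHeegnerData_eq_pow_smul (hK : IsImaginaryQuadratic K) (hn : n ≠ 0)
    (d : KolyvaginHeegnerData Dt β ι n) {ℓ : ℕ} (hℓ : ℓ ∈ n.primeFactors)
    {B : Type*} [AddCommMonoid B] (red : (W.baseChange (ringClassField K ι n)).toAffine.Point →+ B)
    (hσ : ∀ z, red (pointGalHom W (ringClassField K ι n) (d.σ ℓ) z) = red z)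
    {p k : ℕ} (hp : p.Prime) (hp2 : p ≠ 2) (hk : p ^ k ∣ ℓ + 1) :
    ∃ c : ℕ, red d.derivedPoint = (p ^ k) • (c • ∑ s ∈ d.S,
      red (pointGalHom W (ringClassField K ι n) s
        (KolyvaginOperator.derivOpProd (pointGalHom W (ringClassField K ι n)) d.σ (n.primeFactorsList.erase ℓ) d.y))) := by
  obtain ⟨c, hc⟩ := JET.pow_dvd_choose_two hp hp2 hk
  exact ⟨c, by rw [map_derivedPoint_kolyvaginHeegnerData hK hn d hℓ red hσ, hc, mul_nsmul']⟩

end Concrete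

end Summit.BirchSwinnertonDyer.BirchSwinnertonDyer.Theorems.JetchevIrreducibleProp44

end
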